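import Literature.NumberTheory.LFunctions.MoebiusWalshLocalised
import Literature.NumberTheory.LFunctions.MoebiusWalshVaughan
import Mathlib.Algebra.Order.Chebyshev
import HarnessLib

/-!
# Low-weight Walsh factors as short trigonometric polynomials (Bourgain 2013, (3.5)–(3.6)) — proved

Topic `Literature/NumberTheory/LFunctions`; sibling of `MoebiusWalshLocalised.lean` (Lemma 5) and
`MoebiusWalshVaughan.lean` (`natWalsh`). Everything here is PROVED (theorems, and `def`s with
bodies); no named fact.

J. Bourgain, *Möbius–Walsh correlation bounds and an estimate of Mauduit and Rivat*, J. Anal. Math.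
119 (2013) 147–163 = arXiv:1109.2784 [Bourgain2013MoebiusWalsh], §3, (3.5)–(3.6): for the part
`S₂` of the digit set lying in the top `2μ` digits, of small weight `|S₂| < CH`, "`w_{S₂}(x) =
∏_{j∈S₂} h(x/2^{j+1}) = ∑_{k₂∈𝒜₂} ŵ_{S₂}(k₂) e(k₂x/2^λ) + O_{L¹}(2^{-H})` (3.5), where the set `𝒜₂`
may be taken of size `|𝒜₂| < 2^{H|S₂|} < C^{H²}` (3.6) (obtained by truncation of the Fourier
expansion of `h`)". We realise the truncation digit by digit with the de la Vallée-Poussin means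
of Lemma 5 (`MoebiusWalshLocalised.lean`, `σ = 1`), which keeps every truncated factor bounded by
`3` (no Gibbs phenomenon to control) and gives an `L²` error:

* `topDigit t`, `digitWave K₁ t` — the digit `t` as a Lemma-5 digit set (`q = t`, `σ = 1`) and its
  localised wave `W_t` (`< 8K₁` frequencies `k/2^{t+1}`, `|k| < 4K₁`): `abs_digitWave_le` (`≤ 3`),
  `digitWave_add_two_pow` (period `2^{t+1}`), `sum_sq_digitWave_sub_le(_of_lt)`
  (`∑_{x<2^L} (W_t - (-1)^{bit_t})² ≤ 2^L/(2(K₁-1))` for `t < L`, `4K₁ ≤ 2^t`, `K₁ ≥ 2`).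
* `lowWeightMain K₁ T₂ = ∏_{t∈T₂} W_t` — the substitute for `w_{T₂} = natWalsh T₂`:
  `abs_lowWeightMain_le` (`≤ 3^{|T₂|}`), `sum_sq_lowWeightMain_sub_le`
  (**`∑_{x<2^L} (∏W_t - w_{T₂})² ≤ 9^{|T₂|}|T₂|² 2^L/(2(K₁-1))`**, telescoping
  `abs_prod_sub_prod_le` + Cauchy–Schwarz), `abs_lowWeightMain_sub_le` (sup `≤ 3^{|T₂|} + 1`);
* `lowWeightMain_eq_sum`, `lowWeightMain_trigPoly` — **(3.5)–(3.6)**: `∏_t W_t` is a trigonometric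
  polynomial `∑_{κ∈Φ} C(κ) e(-θ(κ)x)` with `|Φ| ≤ (8K₁)^{|T₂|}` and `|C(κ)| ≤ 1`
  (`Finset.prod_sum` over the frequency windows of the factors).

In the type-I estimate (3.7)–(3.9) one takes `K₁ = 2^{O(H)}`, so `|Φ| ≤ 2^{O(H|T₂|)} = C^{H²}` as
printed, while the `L²` error `3^{|T₂|}|T₂|K₁^{-1/2}` is `≤ 2^{-H}`.

## References

* J. Bourgain, J. Anal. Math. 119 (2013) 147–163; arXiv:1109.2784, §3 (3.5)–(3.7); §1 Lemma 5.
  [Bourgain2013MoebiusWalsh]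
-/

noncomputable section

open Finset Real
open Literature.Computability.Complexity

namespace Literature.NumberTheory.LFunctions.MoebiusWalsh

open Literature.NumberTheory.LFunctions.MoebiusWalshVaughan (natWalsh natWalsh_insert abs_natWalsh
  abs_natWalsh_le natWalsh_empty)

/-! ### One binary digit as a Lemma-5 digit set -/

/-- The digit set `{t} ⊆ {0, …, t}` (top digit of `t + 1` digits): Lemma 5 applies to it with
`q = t`, `σ = 1`. [folklore] -/
def topDigit (t : ℕ) : Finset (Fin (t + 1)) := {Fin.last t}

/-- Every digit of `topDigit t` is `≥ t`. [folklore] -/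
theorem le_of_mem_topDigit {t : ℕ} : ∀ j ∈ topDigit t, t ≤ (j : ℕ) := by
  intro j hj
  rw [topDigit, Finset.mem_singleton] at hj
  rw [hj, Fin.val_last]

/-- `w_{topDigit t}(x) = (-1)^{bit_t(x)} = natWalsh {t} x`. [folklore] -/
theorem walshNat_topDigit (t x : ℕ) : walshNat (topDigit t) x = natWalsh {t} x := by
  rw [walshNat_eq_prod, natWalsh, topDigit, Finset.prod_singleton, Finset.prod_singleton, Fin.val_last]

/-- `natWalsh {t}` is `2^{t+1}`-periodic. [folklore] -/
theorem natWalsh_singleton_add_two_pow (t x : ℕ) : natWalsh {t} (x + 2 ^ (t + 1)) = natWalsh {t} x := by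
  rw [← walshNat_topDigit, ← walshNat_topDigit, walshNat_add_two_pow]

/-- **The localised digit wave** `W_t = W_{topDigit t}` of Lemma 5 with `σ = 1`, `q = t` and
truncation parameter `K₁`: a real `2^{t+1}`-periodic trigonometric polynomial with `< 8K₁`
frequencies `k/2^{t+1}`, `|k| < 4K₁`. [cite: Bourgain2013MoebiusWalsh, (1.22), (3.5)] -/
def digitWave (K₁ t : ℕ) (x : ℕ) : ℝ := localisedWalshRe t 1 K₁ (topDigit t) x

/-- `|W_t(x)| ≤ 3` (for `4K₁ ≤ 2^{t+1}`, `K₁ ≥ 1`). [cite: Bourgain2013MoebiusWalsh, (1.22)] -/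
theorem abs_digitWave_le {K₁ t : ℕ} (hK : 0 < K₁) (hKt : 4 * K₁ ≤ 2 ^ (t + 1)) (x : ℕ) :
    |digitWave K₁ t x| ≤ 3 := by
  have h := norm_localisedWalsh_le (q := t) (σ := 1) hK (by rw [pow_one]; omega) (topDigit t) x
  rwa [← coe_localisedWalshRe, Complex.norm_real, Real.norm_eq_abs] at h

/-- `W_t` is `2^{t+1}`-periodic. [folklore] -/
theorem digitWave_add_two_pow (K₁ t x : ℕ) : digitWave K₁ t (x + 2 ^ (t + 1)) = digitWave K₁ t x := by
  have h := localisedWalsh_add_two_pow t 1 K₁ (topDigit t) x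
  rw [← coe_localisedWalshRe, ← coe_localisedWalshRe] at h
  exact_mod_cast h

/-- **Mean-square error of one digit wave over `[0, 2^{t+1})`** (Lemma 5, (1.12)):
`∑_{x<2^{t+1}} (W_t(x) - (-1)^{bit_t x})² ≤ 2^{t+1}/(2(K₁-1))` for `K₁ ≥ 2`, `4K₁ ≤ 2^t`.
[cite: Bourgain2013MoebiusWalsh, Lemma 5 (1.12)] -/
theorem sum_sq_digitWave_sub_le {K₁ t : ℕ} (hK : 2 ≤ K₁) (hKt : 4 * K₁ ≤ 2 ^ t) :
    ∑ x ∈ range (2 ^ (t + 1)), (digitWave K₁ t x - natWalsh {t} x) ^ 2 ≤ 2 ^ (t + 1) / (2 * ((K₁ : ℝ) - 1)) := by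
  have h := sum_norm_sq_localisedWalsh_sub_walshNat_le (q := t) (σ := 1) (K₁ := K₁) (topDigit t)
    le_of_mem_topDigit hK hKt
  refine le_trans (le_of_eq (Finset.sum_congr rfl fun x _ => ?_)) h
  rw [digitWave, ← walshNat_topDigit, ← coe_localisedWalshRe, ← Complex.ofReal_sub, Complex.norm_real,
    Real.norm_eq_abs, sq_abs]

/-! ### Sums of periodic functions over many periods -/

/-- A `P`-periodic function summed over `P·m` consecutive values from `0`. [folklore] -/
theorem sum_range_mul_of_periodic {f : ℕ → ℝ} {P : ℕ} (hper : ∀ x, f (x + P) = f x) (m : ℕ) :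
    ∑ x ∈ range (P * m), f x = m * ∑ x ∈ range P, f x := by
  rw [sum_range_mul_eq_sum_sum]
  have hshift : ∀ (c x : ℕ), f (x + P * c) = f x := by
    intro c
    induction c with
    | zero => intro x; simp
    | succ c ih => intro x; rw [Nat.mul_succ, ← add_assoc, hper, ih]
  rw [Finset.sum_congr rfl fun c _ => Finset.sum_congr rfl fun x _ => hshift c x, Finset.sum_const,
    Finset.card_range, nsmul_eq_mul]

/-- Mean-square error of one digit wave over `[0, 2^L)`, `t < L`:
`∑_{x<2^L} (W_t(x) - (-1)^{bit_t x})² ≤ 2^L/(2(K₁-1))`. [cite: Bourgain2013MoebiusWalsh, Lemma 5 (1.12)] -/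
theorem sum_sq_digitWave_sub_le_of_lt {K₁ t L : ℕ} (hK : 2 ≤ K₁) (hKt : 4 * K₁ ≤ 2 ^ t) (htL : t < L) :
    ∑ x ∈ range (2 ^ L), (digitWave K₁ t x - natWalsh {t} x) ^ 2 ≤ 2 ^ L / (2 * ((K₁ : ℝ) - 1)) := by
  obtain ⟨m, rfl⟩ : ∃ m, L = (t + 1) + m := ⟨L - (t + 1), by omega⟩
  have hper : ∀ x, (fun x => (digitWave K₁ t x - natWalsh {t} x) ^ 2) (x + 2 ^ (t + 1)) =
      (fun x => (digitWave K₁ t x - natWalsh {t} x) ^ 2) x := fun x => by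
    simp only [digitWave_add_two_pow, natWalsh_singleton_add_two_pow]
  rw [pow_add, sum_range_mul_of_periodic hper]
  have hK1 : (1 : ℝ) < K₁ := by exact_mod_cast hK
  calc (2 ^ m : ℕ) * ∑ x ∈ range (2 ^ (t + 1)), (digitWave K₁ t x - natWalsh {t} x) ^ 2
      ≤ (2 ^ m : ℕ) * (2 ^ (t + 1) / (2 * ((K₁ : ℝ) - 1))) :=
        mul_le_mul_of_nonneg_left (sum_sq_digitWave_sub_le hK hKt) (by positivity)
    _ = (2 : ℝ) ^ (t + 1) * 2 ^ m / (2 * ((K₁ : ℝ) - 1)) := by push_cast; ring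
    _ = (2 : ℝ) ^ (t + 1 + m) / (2 * ((K₁ : ℝ) - 1)) := by rw [← pow_add]

/-! ### Products: telescoping -/

/-- **Telescoping bound** for products of reals bounded by `3`:
`|∏_s u - ∏_s w| ≤ 3^{|s|} ∑_{t∈s} |u_t - w_t|`. [folklore] -/
theorem abs_prod_sub_prod_le {ι : Type*} [DecidableEq ι] (s : Finset ι) (u w : ι → ℝ)
    (hu : ∀ t ∈ s, |u t| ≤ 3) (hw : ∀ t ∈ s, |w t| ≤ 3) :
    |∏ t ∈ s, u t - ∏ t ∈ s, w t| ≤ 3 ^ s.card * ∑ t ∈ s, |u t - w t| := by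
  induction s using Finset.induction_on with
  | empty => simp
  | insert a s ha ih =>
    have hu' : ∀ t ∈ s, |u t| ≤ 3 := fun t ht => hu t (Finset.mem_insert_of_mem ht)
    have hw' : ∀ t ∈ s, |w t| ≤ 3 := fun t ht => hw t (Finset.mem_insert_of_mem ht)
    have hprodw : |∏ t ∈ s, w t| ≤ 3 ^ s.card := by
      rw [Finset.abs_prod]
      calc ∏ t ∈ s, |w t| ≤ ∏ _t ∈ s, (3 : ℝ) := Finset.prod_le_prod (fun t _ => abs_nonneg _) hw'
        _ = 3 ^ s.card := by rw [Finset.prod_const]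
    rw [Finset.prod_insert ha, Finset.prod_insert ha, Finset.sum_insert ha, Finset.card_insert_of_notMem ha,
      show u a * ∏ t ∈ s, u t - w a * ∏ t ∈ s, w t =
        u a * (∏ t ∈ s, u t - ∏ t ∈ s, w t) + (u a - w a) * ∏ t ∈ s, w t by ring]
    have h3 : (0 : ℝ) ≤ 3 ^ s.card := by positivity
    have hsum0 : 0 ≤ ∑ t ∈ s, |u t - w t| := Finset.sum_nonneg fun t _ => abs_nonneg _
    calc |u a * (∏ t ∈ s, u t - ∏ t ∈ s, w t) + (u a - w a) * ∏ t ∈ s, w t|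
        ≤ |u a| * |∏ t ∈ s, u t - ∏ t ∈ s, w t| + |u a - w a| * |∏ t ∈ s, w t| := by
          refine (abs_add_le _ _).trans (le_of_eq ?_); rw [abs_mul, abs_mul]
      _ ≤ 3 * (3 ^ s.card * ∑ t ∈ s, |u t - w t|) + |u a - w a| * 3 ^ s.card := by
          gcongr
          · exact hu a (Finset.mem_insert_self a s)
          · exact ih hu' hw'
      _ ≤ 3 ^ (s.card + 1) * (|u a - w a| + ∑ t ∈ s, |u t - w t|) := by
          rw [pow_succ]
          nlinarith [abs_nonneg (u a - w a)]

/-! ### The low-weight factor `w_{T₂}` and its substitute `∏_{t ∈ T₂} W_t` -/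

/-- `w_{T₂} = ∏_{t ∈ T₂} w_{{t}}`. [folklore] -/
theorem natWalsh_eq_prod_singleton (T₂ : Finset ℕ) (x : ℕ) :
    natWalsh T₂ x = ∏ t ∈ T₂, natWalsh {t} x := by
  unfold natWalsh
  simp only [Finset.prod_singleton]

/-- **The substitute for a low-weight Walsh factor** (Bourgain 2013, (3.5): "`w_{S₂}(x) =
∏_{j ∈ S₂} h(x/2^{j+1}) = ∑_{k₂ ∈ 𝒜₂} ŵ_{S₂}(k₂) e(k₂x/2^λ) + O(2^{-H})`, obtained by truncation of
the Fourier expansion of `h`"): the product of the localised digit waves `W_t`, `t ∈ T₂`.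
[cite: Bourgain2013MoebiusWalsh, (3.5)] -/
def lowWeightMain (K₁ : ℕ) (T₂ : Finset ℕ) (x : ℕ) : ℝ := ∏ t ∈ T₂, digitWave K₁ t x

/-- `|∏_t W_t(x)| ≤ 3^{|T₂|}`. [cite: Bourgain2013MoebiusWalsh, (3.5)] -/
theorem abs_lowWeightMain_le {K₁ : ℕ} (hK : 0 < K₁) {T₂ : Finset ℕ} (hT : ∀ t ∈ T₂, 4 * K₁ ≤ 2 ^ (t + 1))
    (x : ℕ) : |lowWeightMain K₁ T₂ x| ≤ 3 ^ T₂.card := by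
  unfold lowWeightMain
  rw [Finset.abs_prod]
  calc ∏ t ∈ T₂, |digitWave K₁ t x| ≤ ∏ _t ∈ T₂, (3 : ℝ) :=
        Finset.prod_le_prod (fun t _ => abs_nonneg _) fun t ht => abs_digitWave_le hK (hT t ht) x
    _ = 3 ^ T₂.card := Finset.prod_const _

/-- **Mean-square error of the substitute** (Bourgain's "`+ O_{L¹}(2^{-H})`" in (3.5), here in `L²`
and explicit): if `K₁ ≥ 2` and every `t ∈ T₂` has `4K₁ ≤ 2^t` and `t < L`, then
`∑_{x<2^L} (∏_t W_t(x) - w_{T₂}(x))² ≤ 9^{|T₂|} |T₂|² 2^L / (2(K₁-1))`.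
[cite: Bourgain2013MoebiusWalsh, (3.5)] -/
theorem sum_sq_lowWeightMain_sub_le {K₁ L : ℕ} (hK : 2 ≤ K₁) {T₂ : Finset ℕ}
    (hT : ∀ t ∈ T₂, 4 * K₁ ≤ 2 ^ t ∧ t < L) :
    ∑ x ∈ range (2 ^ L), (lowWeightMain K₁ T₂ x - natWalsh T₂ x) ^ 2 ≤
      9 ^ T₂.card * T₂.card ^ 2 * 2 ^ L / (2 * ((K₁ : ℝ) - 1)) := by
  classical
  have hK0 : 0 < K₁ := by omega
  have hK1 : (1 : ℝ) < K₁ := by exact_mod_cast hK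
  have hT' : ∀ t ∈ T₂, 4 * K₁ ≤ 2 ^ (t + 1) := fun t ht => (hT t ht).1.trans (Nat.pow_le_pow_right two_pos (by omega))
  -- pointwise telescoping + Cauchy–Schwarz
  have hpt : ∀ x : ℕ, (lowWeightMain K₁ T₂ x - natWalsh T₂ x) ^ 2 ≤
      9 ^ T₂.card * T₂.card * ∑ t ∈ T₂, (digitWave K₁ t x - natWalsh {t} x) ^ 2 := by
    intro x
    have h1 := abs_prod_sub_prod_le T₂ (fun t => digitWave K₁ t x) (fun t => natWalsh {t} x)
      (fun t ht => abs_digitWave_le hK0 (hT' t ht) x) (fun t _ => (abs_natWalsh_le _ _).trans (by norm_num))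
    rw [← natWalsh_eq_prod_singleton] at h1
    have h2 : (∑ t ∈ T₂, |digitWave K₁ t x - natWalsh {t} x|) ^ 2 ≤
        T₂.card * ∑ t ∈ T₂, (digitWave K₁ t x - natWalsh {t} x) ^ 2 := by
      have := sq_sum_le_card_mul_sum_sq (s := T₂) (f := fun t => |digitWave K₁ t x - natWalsh {t} x|)
      simpa only [sq_abs] using this
    have h0 : 0 ≤ ∑ t ∈ T₂, |digitWave K₁ t x - natWalsh {t} x| := Finset.sum_nonneg fun _ _ => abs_nonneg _
    calc (lowWeightMain K₁ T₂ x - natWalsh T₂ x) ^ 2 = |lowWeightMain K₁ T₂ x - natWalsh T₂ x| ^ 2 := (sq_abs _).symm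
      _ ≤ (3 ^ T₂.card * ∑ t ∈ T₂, |digitWave K₁ t x - natWalsh {t} x|) ^ 2 :=
          pow_le_pow_left₀ (abs_nonneg _) h1 2
      _ = 9 ^ T₂.card * (∑ t ∈ T₂, |digitWave K₁ t x - natWalsh {t} x|) ^ 2 := by
          rw [mul_pow, ← pow_mul, show (3 : ℝ) ^ (T₂.card * 2) = 9 ^ T₂.card by
            rw [mul_comm, pow_mul]; norm_num]
      _ ≤ 9 ^ T₂.card * (T₂.card * ∑ t ∈ T₂, (digitWave K₁ t x - natWalsh {t} x) ^ 2) :=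
          mul_le_mul_of_nonneg_left h2 (by positivity)
      _ = _ := by ring
  calc ∑ x ∈ range (2 ^ L), (lowWeightMain K₁ T₂ x - natWalsh T₂ x) ^ 2
      ≤ ∑ x ∈ range (2 ^ L), 9 ^ T₂.card * T₂.card * ∑ t ∈ T₂, (digitWave K₁ t x - natWalsh {t} x) ^ 2 :=
        Finset.sum_le_sum fun x _ => hpt x
    _ = 9 ^ T₂.card * T₂.card * ∑ t ∈ T₂, ∑ x ∈ range (2 ^ L), (digitWave K₁ t x - natWalsh {t} x) ^ 2 := by
        rw [← Finset.mul_sum, Finset.sum_comm]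
    _ ≤ 9 ^ T₂.card * T₂.card * ∑ _t ∈ T₂, (2 ^ L / (2 * ((K₁ : ℝ) - 1))) := by
        refine mul_le_mul_of_nonneg_left (Finset.sum_le_sum fun t ht => ?_) (by positivity)
        exact sum_sq_digitWave_sub_le_of_lt hK (hT t ht).1 (hT t ht).2
    _ = 9 ^ T₂.card * T₂.card ^ 2 * 2 ^ L / (2 * ((K₁ : ℝ) - 1)) := by
        rw [Finset.sum_const, nsmul_eq_mul]; ring

/-- The supremum of the error: `|∏_t W_t(x) - w_{T₂}(x)| ≤ 3^{|T₂|} + 1`. [folklore] -/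
theorem abs_lowWeightMain_sub_le {K₁ : ℕ} (hK : 0 < K₁) {T₂ : Finset ℕ} (hT : ∀ t ∈ T₂, 4 * K₁ ≤ 2 ^ (t + 1))
    (x : ℕ) : |lowWeightMain K₁ T₂ x - natWalsh T₂ x| ≤ 3 ^ T₂.card + 1 :=
  (abs_sub _ _).trans (add_le_add (abs_lowWeightMain_le hK hT x) (abs_natWalsh_le _ _))

/-! ### The substitute is a short trigonometric polynomial -/

/-- **Expansion of `∏_t W_t`**: with `I = (-4K₁, 4K₁) ∩ ℤ` the common frequency window of the
digit waves,
`∏_{t∈T₂} W_t(x) = ∑_{κ : T₂ → I} (∏_t Ŵ_t(κ_t)) e(-x ∑_t κ_t/2^{t+1})`. [cite: Bourgain2013MoebiusWalsh, (3.5)–(3.7)] -/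
theorem lowWeightMain_eq_sum (K₁ : ℕ) (T₂ : Finset ℕ) (x : ℕ) :
    (lowWeightMain K₁ T₂ x : ℂ) =
      ∑ κ ∈ T₂.pi (fun _ => Ioo (-((2 * (K₁ * 2 ^ 1) : ℕ) : ℤ)) ((2 * (K₁ * 2 ^ 1) : ℕ) : ℤ)),
        (∏ t ∈ T₂.attach, localisedCoeff (t : ℕ) 1 K₁ (topDigit t) (κ t t.2)) *
          eChar (-(x * ∑ t ∈ T₂.attach, ((κ t t.2 : ℤ) : ℝ) / 2 ^ ((t : ℕ) + 1))) := by
  unfold lowWeightMain digitWave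
  rw [Complex.ofReal_prod]
  simp_rw [coe_localisedWalshRe]
  unfold localisedWalsh
  rw [Finset.prod_sum]
  refine Finset.sum_congr rfl fun κ _ => ?_
  rw [Finset.prod_mul_distrib, ← eChar_sum, Finset.mul_sum, ← Finset.sum_neg_distrib]
  congr 2
  refine Finset.sum_congr rfl fun t _ => ?_
  ring

/-- **(3.5)–(3.6) packaged**: `∏_{t∈T₂} W_t` is a trigonometric polynomial `∑_{κ∈Φ} C(κ)e(-θ(κ)x)`
with `|Φ| ≤ (8K₁)^{|T₂|}` frequencies (Bourgain: "`|𝒜₂| < 2^{H|S₂|} < C^{H²}`") and coefficients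
`|C(κ)| ≤ 1`. [cite: Bourgain2013MoebiusWalsh, (3.5)–(3.6)] -/
theorem lowWeightMain_trigPoly (K₁ : ℕ) (T₂ : Finset ℕ) :
    ∃ (ι : Type) (Φ : Finset ι) (C : ι → ℂ) (θ : ι → ℝ),
      (Φ.card : ℝ) ≤ (8 * K₁ : ℝ) ^ T₂.card ∧ (∀ κ ∈ Φ, ‖C κ‖ ≤ 1) ∧
      ∀ x : ℕ, (lowWeightMain K₁ T₂ x : ℂ) = ∑ κ ∈ Φ, C κ * eChar (-(θ κ * x)) := by
  classical
  refine ⟨((t : ℕ) → t ∈ T₂ → ℤ),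
    T₂.pi (fun _ => Ioo (-((2 * (K₁ * 2 ^ 1) : ℕ) : ℤ)) ((2 * (K₁ * 2 ^ 1) : ℕ) : ℤ)),
    fun κ => ∏ t ∈ T₂.attach, localisedCoeff (t : ℕ) 1 K₁ (topDigit t) (κ t t.2),
    fun κ => ∑ t ∈ T₂.attach, ((κ t t.2 : ℤ) : ℝ) / 2 ^ ((t : ℕ) + 1), ?_, ?_, fun x => ?_⟩
  · rw [Finset.card_pi, Finset.prod_const, Int.card_Ioo]
    push_cast
    refine pow_le_pow_left₀ (Nat.cast_nonneg _) ?_ _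
    have : (((2 * (K₁ * 2 ^ 1) : ℕ) : ℤ) - -((2 * (K₁ * 2 ^ 1) : ℕ) : ℤ) - 1).toNat ≤ 8 * K₁ := by omega
    exact_mod_cast this
  · intro κ _
    rw [Complex.norm_prod]
    refine Finset.prod_le_one (fun t _ => norm_nonneg _) fun t _ => ?_
    exact (norm_localisedCoeff_le _ _ _ _ _).trans (norm_walshCoeff_le_one _ _)
  · rw [lowWeightMain_eq_sum]
    refine Finset.sum_congr rfl fun κ _ => ?_
    congr 2
    ring

end Literature.NumberTheory.LFunctions.MoebiusWalsh

end
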